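import Summits.QuantumFields.YangMills.Theses.ConvexGribovBody
import Summits.QuantumFields.YangMills.Theorems.ConvexGribovBodyNonSimplyConnectedLatticeGapAdmissibleInstance
import Literature.MathematicalPhysics.QuantumLattice.GaugeGroups
import Literature.AlgebraicTopology.FundamentalGroup.RotationGroupSO3
import HarnessLib

/-!
# Crux `NonSimplyConnectedLatticeGap` (stmt-QuantumFields-16405), route `ConvexGribovBody`, line
# `twist-equipartition-blindness` — the universal cover of `SO(3)` in the shape of stub COVER

Stub COVER (`stub_universalCover`) of the skeleton line `twist-equipartition-blindness` asserts that every
compact simple Lie group `G` in the crux's sense (`IsCompactSimpleLieGroup G`: connected, non-abelian, every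
closed preconnected normal subgroup `⊥` or `⊤`, a faithful continuous unitary matrix representation) which is
NOT simply connected is covered by a compact, simply connected `H`, again `IsCompactSimpleLieGroup`, through
a continuous surjective homomorphism `π : H →* G` whose kernel is central, finite and non-trivial (the
universal covering group; Weyl's theorem). In general this needs Lie structure theory absent from Mathlib
(the universal covering GROUP, Sepanski Thm. 1.22; compactness of the universal cover of a compact
semisimple group, Bröcker–tom Dieck V (7.1) with Remark (7.13), Sepanski Cor. 6.33; faithful representations
of compact Lie groups, Bröcker–tom Dieck III (4.1)).

This file proves the conclusion of COVER for the one admissible instance certified in the tree,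
`G = SO(3)` (`so3_admissible`), with `H = S³` the unit quaternions and `π = rotHom` (Hatcher §3.D):

* `nonempty_latticeRep_sphere_quaternion`, `isCompactSimpleLieGroup_sphere` — `S³` is a compact simple
  Lie group in the crux's sense (simplicity clause: the landed `isSimpleCompactGroup_sphere`; faithful
  unitary representation: the fundamental representation of `SU(2)` through the landed `S³ ≃* SU(2)`,
  `stub_sphere_mulEquiv_su2`);
* `ker_rotHom_le_center`, `ker_rotHom_eq_center`, `finite_ker_rotHom`, `ker_rotHom_ne_bot` — the kernel
  `{±1}` of `rotHom : S³ →* SO(3)` is central (indeed equal to the centre, with the landed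
  `stub_center_sphere_le_ker_rotHom`), finite and non-trivial;
* `universalCover_SO3` — the conclusion of COVER at `G = SO(3)`: the datum
  `(S³, rotHom)` with all seven clauses (`S³` simply connected: tree `simplyConnectedSpace_sphere_quaternion`);
* `stub_universalCover_SO3` — COVER's registered shape specialised to `G = SO(3)` with the landed instances
  `so3_isTopologicalGroup`, `so3_compactSpace`.

Nothing here asserts a Theses statement; the file supports the crux item. No named unproved facts are used.
-/

set_option autoImplicit false

noncomputable section

namespace Summit.QuantumFields.YangMills.Theorems.NonSimplyConnectedLatticeGap

open Literature.MathematicalPhysics.QuantumFieldTheory Literature.MathematicalPhysics.QuantumLattice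
open Literature.AlgebraicTopology.FundamentalGroup

/-- **The unit quaternions carry a faithful continuous unitary matrix representation**: the fundamental
representation of `SU(2)` composed with the landed topological-group isomorphism `S³ ≃* SU(2)`
(`stub_sphere_mulEquiv_su2`). [folklore] -/
theorem nonempty_latticeRep_sphere_quaternion :
    Nonempty (LatticeRep (Metric.sphere (0 : Quaternion ℝ) 1)) := by
  obtain ⟨e, he, -, -⟩ := stub_sphere_mulEquiv_su2
  refine ⟨⟨2, (fundamentalRep (Fin 2)).comp e.toMonoidHom, ?_, ?_, ?_⟩⟩
  · exact (continuous_fundamentalRep (Fin 2)).comp he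
  · exact (fundamentalRep_injective (Fin 2)).comp e.injective
  · intro g
    exact fundamentalRep_mem_unitaryGroup _

/-- **`S³` (the unit quaternions) is a compact simple Lie group in the crux's sense**
(`IsCompactSimpleLieGroup = IsSimpleCompactGroup ∧ Nonempty LatticeRep`): the simplicity clause is the
landed `isSimpleCompactGroup_sphere` (transported from `SU(2)`), the faithful unitary representation is
`nonempty_latticeRep_sphere_quaternion`. [folklore] -/
theorem isCompactSimpleLieGroup_sphere : IsCompactSimpleLieGroup (Metric.sphere (0 : Quaternion ℝ) 1) :=
  ⟨isSimpleCompactGroup_sphere, nonempty_latticeRep_sphere_quaternion⟩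

/-- **The kernel `{±1}` of `S³ → SO(3)` is central.** [cite: HatcherAT2002, §3.D] -/
theorem ker_rotHom_le_center : rotHom.ker ≤ Subgroup.center (Metric.sphere (0 : Quaternion ℝ) 1) := by
  intro q hq
  rw [Subgroup.mem_center_iff]
  intro g
  rcases (mem_ker_rotHom_iff q).1 hq with h1 | h1
  · rw [h1, mul_one, one_mul]
  · rw [h1, mul_neg_one, neg_one_mul]

/-- **The kernel of `S³ → SO(3)` is exactly the centre `{±1}` of `S³`** (with the landed
`stub_center_sphere_le_ker_rotHom`). [cite: HatcherAT2002, §3.D] -/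
theorem ker_rotHom_eq_center : rotHom.ker = Subgroup.center (Metric.sphere (0 : Quaternion ℝ) 1) :=
  le_antisymm ker_rotHom_le_center stub_center_sphere_le_ker_rotHom

/-- **The kernel of `S³ → SO(3)` is finite** (it is `{1, -1}`, tree `coe_ker_rotHom`). [cite: HatcherAT2002, §3.D] -/
theorem finite_ker_rotHom : (rotHom.ker : Set (Metric.sphere (0 : Quaternion ℝ) 1)).Finite := by
  rw [coe_ker_rotHom]
  exact Set.toFinite _

/-- **The kernel of `S³ → SO(3)` is non-trivial**: it contains `-1 ≠ 1`. [cite: HatcherAT2002, §3.D] -/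
theorem ker_rotHom_ne_bot : rotHom.ker ≠ ⊥ := by
  intro h
  have hm : (-1 : Metric.sphere (0 : Quaternion ℝ) 1) ∈ rotHom.ker := (mem_ker_rotHom_iff _).2 (Or.inr rfl)
  rw [h, Subgroup.mem_bot] at hm
  exact one_ne_neg_one_sphere hm.symm

/-- **The universal cover of `SO(3)` in the shape of stub COVER.** `H = S³` (unit quaternions, Borel
σ-algebra) is a compact simple Lie group in the crux's sense and simply connected, and
`π = rotHom : S³ →* SO(3)` is a continuous surjective homomorphism whose kernel `{±1}` is central, finite
and non-trivial — the conclusion of `stub_universalCover` at `G = SO(3)`. [cite: HatcherAT2002, §3.D] -/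
theorem universalCover_SO3 :
    ∃ (H : Type) (_ : Group H) (_ : TopologicalSpace H) (_ : IsTopologicalGroup H) (_ : CompactSpace H)
      (_ : MeasurableSpace H) (_ : BorelSpace H) (π : H →* Literature.AlgebraicTopology.FundamentalGroup.SO3),
      Literature.MathematicalPhysics.QuantumFieldTheory.IsCompactSimpleLieGroup H ∧ SimplyConnectedSpace H ∧
        Continuous π ∧ Function.Surjective π ∧ π.ker ≤ Subgroup.center H ∧ (π.ker : Set H).Finite ∧
          π.ker ≠ ⊥ := by
  letI : MeasurableSpace (Metric.sphere (0 : Quaternion ℝ) 1) := borel _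
  haveI : BorelSpace (Metric.sphere (0 : Quaternion ℝ) 1) := ⟨rfl⟩
  exact ⟨Metric.sphere (0 : Quaternion ℝ) 1, inferInstance, inferInstance, inferInstance, inferInstance,
    inferInstance, inferInstance, rotHom, isCompactSimpleLieGroup_sphere, inferInstance, continuous_rotHom,
    surjective_rotHom, ker_rotHom_le_center, finite_ker_rotHom, ker_rotHom_ne_bot⟩

/-- **Stub COVER holds at `G = SO(3)`**: the registered signature of `stub_universalCover` specialised to
`SO(3)` with its landed instances (`so3_isTopologicalGroup`, `so3_compactSpace`; the hypotheses
`IsCompactSimpleLieGroup SO3`, `¬ SimplyConnectedSpace SO3` hold by `so3_admissible` and are not needed for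
the conclusion). [cite: HatcherAT2002, §3.D] -/
theorem stub_universalCover_SO3 :
    @IsCompactSimpleLieGroup SO3 _ _ so3_compactSpace → ¬ SimplyConnectedSpace SO3 →
      ∃ (H : Type) (_ : Group H) (_ : TopologicalSpace H) (_ : IsTopologicalGroup H) (_ : CompactSpace H)
        (_ : MeasurableSpace H) (_ : BorelSpace H) (π : H →* SO3),
        IsCompactSimpleLieGroup H ∧ SimplyConnectedSpace H ∧ Continuous π ∧ Function.Surjective π ∧
          π.ker ≤ Subgroup.center H ∧ (π.ker : Set H).Finite ∧ π.ker ≠ ⊥ :=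
  fun _ _ => universalCover_SO3

end Summit.QuantumFields.YangMills.Theorems.NonSimplyConnectedLatticeGap

end
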